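import Mathlib
import HarnessLib
import Summits.HubbardSuperconductivity.HubbardSuperconductivity.Theorems.KLProgrammeKLRegimeWickLegDressingModel

/-!
# Route `KLProgramme` — ENGINE child (stmt-HubbardSuperconductivity-19918 / gen-6 successor), (E2-v10) leg-dress line: p1 g9's exact
# leg-dressing identity `vertexFn_dblFold_oneLine` for an ARBITRARY even action with two-leg selection (cell gate-hubbard-kl, seat
# hubbard-kl-k3c2-p3 g3, row «leg-dress bar»; generic twin of `…WickLegDressingModel` §2, whose proof it follows line by line)

`…WickLegDressingModel` proves, for the Wick action `𝒲_n`,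
`𝒱₄(dblFold(Δ_×(C)(𝒲_n⁰𝒲_n¹)))(Z) = 2·(βL²)⁻¹·𝒱₄(𝒲_n)(Z)·Σ_{i<4} ℓ(p_i)·Σ^W_n(p_i,σ_i)`, using of `𝒲_n` only (i) evenness and (ii) TWO-LEG SELECTION
(`kernel 𝒲_n 2 (ψ̂⁺_{pσ}, Y′) = 0` unless `Y′ = ψ̂⁻_{pσ}`, and the mirror statement).  Here the same identity is stated for ANY
`W : HubbardGrassmann L M` with (i),(ii) as hypotheses, the self-energy being the tree's `selfEnergy L M β W`:
**`vertexFn_dblFold_oneLine_of_twoLeg`**.  Instances: `W = 𝒲_n` (p1's theorem), `W = 𝒱_n = klEffectiveAction … n` (the PLAIN carriers of the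
engine slots, whose `selfEnergy` is `klSelfEnergy` — the object `RenormalisedAtF`/`TwoLegSlopes` and `…SplitLegDressing` read; selection for `𝒱_n`
from `kernel_klEffectiveAction_eq_zero_of_weight_ne`, next file), the real-cutoff carrier `W_Λ` of the continuous route.  Proved; no definitions.
-/

noncomputable section

namespace Summit.HubbardSuperconductivity.HubbardSuperconductivity.Theorems.KLRegimeWick

set_option linter.dupNamespace false -- summit = problem name (single-conjunct summit), D-0017

open Literature.MathematicalPhysics.QuantumLattice GrassmannAlgebra Finset Matrix
open Literature.Probability.LatticeModels
open Summit.HubbardSuperconductivity.HubbardSuperconductivity.Theorems.TwoPointAssembly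
open Summit.HubbardSuperconductivity.HubbardSuperconductivity.Theorems.KLProgrammeLegKernels
open Summit.HubbardSuperconductivity.HubbardSuperconductivity.Theorems.KLRegimeSplit

section Generic

variable {L M : ℕ} [NeZero L] (β : ℝ)

/-- **`oneLineSum_diagContr_of_twoLeg`** — against a diagonal line the one-line sum localises on the external leg, for any `W` with two-leg
selection: `Σ_{X,Y} diagContr ℓ X Y · kernel W 2 (X, Zi) · kernel W 4 (Y, R) = ℓ(p)·kernel W 2 (ψ̂⁻_{pσ}, ψ̂⁺_{pσ})·kernel W 4 (Zi, R)` (`Zi = ψ̂^±_{pσ}`). -/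
theorem oneLineSum_diagContr_of_twoLeg (W : HubbardGrassmann L M)
    (hplus : ∀ (p : FreqMomentum L M) (σ : Fin 2) (Y' : HubbardFieldIdx L M), Y' ≠ ((p, σ), 1) → kernel ℂ W 2 ![((p, σ), 0), Y'] = 0)
    (hminus : ∀ (p : FreqMomentum L M) (σ : Fin 2) (Y' : HubbardFieldIdx L M), Y' ≠ ((p, σ), 0) → kernel ℂ W 2 ![((p, σ), 1), Y'] = 0)
    (ℓ : FreqMomentum L M → ℂ) (Zi : HubbardFieldIdx L M) (R : Fin 3 → HubbardFieldIdx L M) :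
    ∑ X, ∑ Y, diagContr L M ℓ X Y * (kernel ℂ W 2 ![X, Zi] * kernel ℂ W 4 (Matrix.vecCons Y R)) =
      ℓ Zi.1.1 * (kernel ℂ W 2 ![(Zi.1, 1), (Zi.1, 0)] * kernel ℂ W 4 (Matrix.vecCons Zi R)) := by
  classical
  rw [sum_diagContr_mul]
  obtain ⟨⟨q, τ⟩, c⟩ := Zi
  -- the two-leg kernel pairs only reciprocal labels (second slot fixed: swap to put the free label second)
  have hmm : ∀ (p : FreqMomentum L M) (σ : Fin 2), kernel ℂ W 2 ![((p, σ), 1), ((q, τ), 1)] = 0 :=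
    fun p σ => hminus p σ _ (by simp)
  have hpp : ∀ (p : FreqMomentum L M) (σ : Fin 2), kernel ℂ W 2 ![((p, σ), 0), ((q, τ), 0)] = 0 :=
    fun p σ => hplus p σ _ (by simp)
  fin_cases c
  · simp only [Fin.zero_eta, Fin.isValue, hpp, zero_mul, sub_zero]
    rw [← Fintype.sum_prod_type']
    rw [Finset.sum_eq_single (((q, τ)) : FreqMomentum L M × Fin 2) (fun x _ hx => ?_) (fun h => absurd (Finset.mem_univ _) h)]
    obtain ⟨p, σ⟩ := x
    dsimp only
    rw [hminus p σ _ (fun h => hx (by simpa using h.symm)), zero_mul, mul_zero]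
  · simp only [Fin.mk_one, Fin.isValue, hmm, zero_mul, zero_sub, mul_neg]
    rw [← Fintype.sum_prod_type']
    rw [Finset.sum_eq_single (((q, τ)) : FreqMomentum L M × Fin 2) (fun x _ hx => ?_) (fun h => absurd (Finset.mem_univ _) h)]
    · dsimp only
      rw [kernel_two_swap01 W ((q, τ), 1) ((q, τ), 0)]
      ring
    · obtain ⟨p, σ⟩ := x
      dsimp only
      rw [hplus p σ _ (fun h => hx (by simpa using h.symm)), zero_mul, mul_zero, neg_zero]

/-- **`vertexFn_dblFold_oneLine_of_twoLeg` — external-leg dressing, exactly, for any even action with two-leg selection.**  For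
`W : HubbardGrassmann L M` even, pairing only reciprocal labels in degree `2`, any diagonal line `C` (values `ℓ`) and ANY four external legs
`Z = (ψ̂^{c_i}_{p_iσ_i})_{i<4}`:
`𝒱₄(dblFold(Δ_×(C)(W⁰·W¹)))(Z) = 2·(βL²)⁻¹ · 𝒱₄(W)(Z) · Σ_{i<4} ℓ(p_i)·selfEnergy(W)(p_i, σ_i)`. -/
theorem vertexFn_dblFold_oneLine_of_twoLeg (hβ : β ≠ 0) {C : Matrix (HubbardFieldIdx L M) (HubbardFieldIdx L M) ℂ}
    {ℓ : FreqMomentum L M → ℂ} (hC : contr ℂ C = diagContr L M ℓ) (W : HubbardGrassmann L M) (hW0 : W ∈ evenOdd ℂ 0)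
    (hplus : ∀ (p : FreqMomentum L M) (σ : Fin 2) (Y' : HubbardFieldIdx L M), Y' ≠ ((p, σ), 1) → kernel ℂ W 2 ![((p, σ), 0), Y'] = 0)
    (hminus : ∀ (p : FreqMomentum L M) (σ : Fin 2) (Y' : HubbardFieldIdx L M), Y' ≠ ((p, σ), 0) → kernel ℂ W 2 ![((p, σ), 1), Y'] = 0)
    (Z : Fin 4 → HubbardFieldIdx L M) :
    vertexFn L M β (dblFold ℂ (grassmannLaplacian ℂ (crossCov ℂ C) (dblCopy ℂ 0 W * dblCopy ℂ 1 W))) 4 Z =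
      2 * (((β * (L : ℝ) ^ 2 : ℝ) : ℂ))⁻¹ * vertexFn L M β W 4 Z *
        ∑ i : Fin 4, ℓ (Z i).1.1 * selfEnergy L M β W (Z i).1.1 (Z i).1.2 := by
  have hL : (L : ℝ) ≠ 0 := Nat.cast_ne_zero.2 (NeZero.ne L)
  have hb : (((β * (L : ℝ) ^ 2 : ℝ) : ℂ)) ≠ 0 := by exact_mod_cast mul_ne_zero hβ (pow_ne_zero 2 hL)
  obtain ⟨e4, -, e2⟩ := vertexFn_consts_eq (L := L) β
  have hZ : (![Z 0, Z 1, Z 2, Z 3] : Fin 4 → HubbardFieldIdx L M) = Z := by funext i; fin_cases i <;> rfl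
  rw [vertexFn_def, show (4 - 1 : ℕ) = 3 from rfl, kernel_dblFold_oneLine_self ℂ C hW0 Z, hC,
    oneLineSum_diagContr_of_twoLeg W hplus hminus ℓ (Z 0) ![Z 1, Z 2, Z 3],
    oneLineSum_diagContr_of_twoLeg W hplus hminus ℓ (Z 1) ![Z 0, Z 2, Z 3],
    oneLineSum_diagContr_of_twoLeg W hplus hminus ℓ (Z 2) ![Z 0, Z 1, Z 3],
    oneLineSum_diagContr_of_twoLeg W hplus hminus ℓ (Z 3) ![Z 0, Z 1, Z 2]]
  rw [show (Matrix.vecCons (Z 0) ![Z 1, Z 2, Z 3] : Fin 4 → HubbardFieldIdx L M) = ![Z 0, Z 1, Z 2, Z 3] from rfl,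
    show (Matrix.vecCons (Z 1) ![Z 0, Z 2, Z 3] : Fin 4 → HubbardFieldIdx L M) = ![Z 1, Z 0, Z 2, Z 3] from rfl,
    show (Matrix.vecCons (Z 2) ![Z 0, Z 1, Z 3] : Fin 4 → HubbardFieldIdx L M) = ![Z 2, Z 0, Z 1, Z 3] from rfl,
    show (Matrix.vecCons (Z 3) ![Z 0, Z 1, Z 2] : Fin 4 → HubbardFieldIdx L M) = ![Z 3, Z 0, Z 1, Z 2] from rfl,
    kernel_four_swap01 W (Z 0) (Z 1), kernel_four_rot3 W (Z 0) (Z 1) (Z 2), kernel_four_rot4 W (Z 0) (Z 1) (Z 2), hZ]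
  simp only [Fin.sum_univ_four, selfEnergy]
  rw [kernel_two_swap01 _ ((Z 0).1, 0) ((Z 0).1, 1), kernel_two_swap01 _ ((Z 1).1, 0) ((Z 1).1, 1),
    kernel_two_swap01 _ ((Z 2).1, 0) ((Z 2).1, 1), kernel_two_swap01 _ ((Z 3).1, 0) ((Z 3).1, 1),
    kernel_two_eq_inv_mul_vertexFn β hβ, kernel_two_eq_inv_mul_vertexFn β hβ, kernel_two_eq_inv_mul_vertexFn β hβ,
    kernel_two_eq_inv_mul_vertexFn β hβ, kernel_four_eq_inv_mul_vertexFn β hβ, e4, e2]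
  simp only [Prod.mk.eta]
  field_simp
  ring

/-- **Norm form**: `‖𝒱₄(dblFold(Δ_×(C)(W⁰W¹)))(Z)‖ ≤ 2(βL²)⁻¹·‖𝒱₄(W)(Z)‖·Σ_i ‖ℓ(p_i)‖·‖selfEnergy W (p_i,σ_i)‖` (`β > 0`). -/
theorem norm_vertexFn_dblFold_oneLine_of_twoLeg_le (hβ : 0 < β) {C : Matrix (HubbardFieldIdx L M) (HubbardFieldIdx L M) ℂ}
    {ℓ : FreqMomentum L M → ℂ} (hC : contr ℂ C = diagContr L M ℓ) (W : HubbardGrassmann L M) (hW0 : W ∈ evenOdd ℂ 0)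
    (hplus : ∀ (p : FreqMomentum L M) (σ : Fin 2) (Y' : HubbardFieldIdx L M), Y' ≠ ((p, σ), 1) → kernel ℂ W 2 ![((p, σ), 0), Y'] = 0)
    (hminus : ∀ (p : FreqMomentum L M) (σ : Fin 2) (Y' : HubbardFieldIdx L M), Y' ≠ ((p, σ), 0) → kernel ℂ W 2 ![((p, σ), 1), Y'] = 0)
    (Z : Fin 4 → HubbardFieldIdx L M) :
    ‖vertexFn L M β (dblFold ℂ (grassmannLaplacian ℂ (crossCov ℂ C) (dblCopy ℂ 0 W * dblCopy ℂ 1 W))) 4 Z‖ ≤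
      2 * (β * (L : ℝ) ^ 2)⁻¹ * ‖vertexFn L M β W 4 Z‖ * ∑ i : Fin 4, ‖ℓ (Z i).1.1‖ * ‖selfEnergy L M β W (Z i).1.1 (Z i).1.2‖ := by
  have hL : (0 : ℝ) < (L : ℝ) := Nat.cast_pos.2 (Nat.pos_of_ne_zero (NeZero.ne L))
  have hβL : 0 < β * (L : ℝ) ^ 2 := by positivity
  rw [vertexFn_dblFold_oneLine_of_twoLeg β hβ.ne' hC W hW0 hplus hminus Z, norm_mul, norm_mul, norm_mul, norm_inv, Complex.norm_real,
    Real.norm_of_nonneg hβL.le, Complex.norm_ofNat]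
  refine mul_le_mul_of_nonneg_left ((norm_sum_le _ _).trans (le_of_eq ?_)) (by positivity)
  refine Finset.sum_congr rfl fun i _ => ?_
  rw [norm_mul]

end Generic

end Summit.HubbardSuperconductivity.HubbardSuperconductivity.Theorems.KLRegimeWick

end
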